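/-
Origin: expansion seat `planner-pub-hodgecm-pv14-g6-0`, handover import Pv14g6.SchwartzExpFlow -> import HodgeCM.Automorphic.SchwartzExpFlow (Mathlib imports untouched) ; after t31 row 13 (SchwartzExpFlow) (`HOME/pub-hodgecm-pv14-g6/lean/Pv14g6/SchwartzExpFlowRotation.lean`, md5 050c8170, 114 lines);
landed by the gen-8 packager in gate run 31 as `HodgeCM/Automorphic/SchwartzExpFlowRotation.lean` (import ^import Pv14g6\.SchwartzExpFlow[ \t]*$→import HodgeCM.Automorphic.SchwartzExpFlow ×1).
-/
/-
Copyright: HodgeCM public adjudication package, seat pub-hodgecm-pv14-g6 (DAG-NODE PROVER #14, gen 6).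
File #32 of this seat.  Kernel-checked, no new axioms.  Imports file #28 of this seat and Mathlib.
-/
import Summits.HodgeConjecture.HodgeCM.Automorphic.SchwartzExpFlow
import Mathlib.Analysis.Calculus.MeanValue
import Mathlib.Analysis.SpecialFunctions.Trigonometric.Deriv

/-!
# `exp(sA) = cos s · 1 + sin s · A` for `A² = -1`: compact one-parameter subgroups (rotations)

The elliptic companion of file #30: for a complex structure `A` (`A² = -1`) on `E` the exponential flow
of file #28 is the rotation group `exp(sA) = cos s · 1 + sin s · A` (period `2π`), proved by the same
derivative argument `d/ds [exp(sA) (cos s · 1 - sin s · A)] = 0` — no power series are rearranged.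
Hence the `exp(sA)` smooth-vector clauses of files #28/#29 cover the compact Levi one-parameter subgroups
`SO(2) ⊂ GL(V)` in closed form (`expFlow_apply_eq_cos_add_sin`).

Only published mathematics is used (Mathlib); nothing here refers to the objects under adjudication.
-/

noncomputable section

open Filter Topology

namespace HodgeCM
namespace SchwartzWeil

section ExpRotation

variable {E : Type*} [NormedAddCommGroup E] [NormedSpace ℝ E] (A : E →L[ℝ] E)

/-- The closed form `cos s · 1 + sin s · A`. -/
def cosSinCLM (s : ℝ) : E →L[ℝ] E := Real.cos s • 1 + Real.sin s • A

/-- (Ported verbatim from the HodgeCMPerL package; no docstring in the source.) -/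
theorem cosSinCLM_def (s : ℝ) : cosSinCLM A s = Real.cos s • 1 + Real.sin s • A := rfl

/-- (Ported verbatim from the HodgeCMPerL package; no docstring in the source.) -/
theorem cosSinCLM_apply (s : ℝ) (x : E) : cosSinCLM A s x = Real.cos s • x + Real.sin s • A x := by
  simp [cosSinCLM]

/-- (Ported verbatim from the HodgeCMPerL package; no docstring in the source.) -/
theorem cosSinCLM_zero : cosSinCLM A 0 = 1 := by
  simp [cosSinCLM]

variable (hA : A * A = -1)
include hA

/-- The group law from the addition formulas and `A² = -1`. -/
theorem cosSinCLM_add (s t : ℝ) : cosSinCLM A (s + t) = cosSinCLM A s * cosSinCLM A t := by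
  simp only [cosSinCLM, Real.cos_add, Real.sin_add, mul_add, add_mul, smul_mul_smul_comm, mul_one,
    one_mul, hA, add_smul, sub_eq_add_neg, smul_neg, neg_smul]
  abel

/-- `d/ds (cos s · 1 - sin s · A) = -A · (cos s · 1 - sin s · A)`, i.e. the derivative of
`s ↦ cosSinCLM A (-s)`. -/
theorem hasDerivAt_cosSinCLM_neg (s₀ : ℝ) :
    HasDerivAt (fun s => cosSinCLM A (-s)) (-(A * cosSinCLM A (-s₀))) s₀ := by
  have h := ((Real.hasDerivAt_cos s₀).smul_const (1 : E →L[ℝ] E)).sub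
    ((Real.hasDerivAt_sin s₀).smul_const A)
  have e : -Real.sin s₀ • (1 : E →L[ℝ] E) - Real.cos s₀ • A = -(A * cosSinCLM A (-s₀)) := by
    simp only [cosSinCLM, Real.cos_neg, Real.sin_neg, mul_add, mul_smul_comm, mul_one, hA, neg_smul,
      mul_neg, neg_add, neg_neg, smul_neg]
    abel
  rw [← e]
  refine h.congr_of_eventuallyEq (Eventually.of_forall fun s => ?_)
  show cosSinCLM A (-s) = Real.cos s • (1 : E →L[ℝ] E) - Real.sin s • A
  rw [cosSinCLM, Real.cos_neg, Real.sin_neg, neg_smul, sub_eq_add_neg]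

variable [CompleteSpace E]

/-- The conserved quantity: `exp(sA) · (cos s · 1 - sin s · A) = 1` for all `s`. -/
theorem expCLM_mul_cosSinCLM_neg (s : ℝ) : expCLM A s * cosSinCLM A (-s) = 1 := by
  have hd : ∀ t : ℝ, HasDerivAt (fun t => expCLM A t * cosSinCLM A (-t)) 0 t := by
    intro t
    have h1 : HasDerivAt (fun t : ℝ => expCLM A t) (A * NormedSpace.exp (t • A)) t :=
      hasDerivAt_exp_smul_const' A t
    have h := h1.mul (hasDerivAt_cosSinCLM_neg A hA t)
    have hc : A * NormedSpace.exp (t • A) = NormedSpace.exp (t • A) * A :=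
      (((Commute.refl A).smul_right t).exp_right).eq
    have e : A * NormedSpace.exp (t • A) * cosSinCLM A (-t)
        + expCLM A t * -(A * cosSinCLM A (-t)) = 0 := by
      rw [hc, expCLM_def, mul_neg, mul_assoc, add_neg_cancel]
    rw [← e]
    exact h
  have hconst := is_const_of_deriv_eq_zero (fun t => (hd t).differentiableAt) (fun t => (hd t).deriv)
  rw [hconst s 0, expCLM_zero, neg_zero, cosSinCLM_zero, one_mul]

/-- **`exp(sA) = cos s · 1 + sin s · A`** for `A² = -1`. -/
theorem expCLM_eq_cosSinCLM (s : ℝ) : expCLM A s = cosSinCLM A s := by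
  calc expCLM A s = expCLM A s * (cosSinCLM A (-s) * cosSinCLM A s) := by
        rw [← cosSinCLM_add A hA, neg_add_cancel, cosSinCLM_zero, mul_one]
    _ = cosSinCLM A s := by rw [← mul_assoc, expCLM_mul_cosSinCLM_neg A hA, one_mul]

/-- (Ported verbatim from the HodgeCMPerL package; no docstring in the source.) -/
theorem exp_smul_eq_cos_add_sin (s : ℝ) :
    NormedSpace.exp (s • A) = Real.cos s • (1 : E →L[ℝ] E) + Real.sin s • A :=
  expCLM_eq_cosSinCLM A hA s

/-- (Ported verbatim from the HodgeCMPerL package; no docstring in the source.) -/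
theorem coe_expFlow_eq_cosSinCLM (s : ℝ) :
    ((expFlow A s : E ≃L[ℝ] E) : E →L[ℝ] E) = cosSinCLM A s := by
  rw [coe_expFlow, exp_smul_eq_cos_add_sin A hA, cosSinCLM_def]

/-- (Ported verbatim from the HodgeCMPerL package; no docstring in the source.) -/
theorem expFlow_apply_eq_cos_add_sin (s : ℝ) (x : E) :
    expFlow A s x = Real.cos s • x + Real.sin s • A x := by
  rw [expFlow_apply, exp_smul_eq_cos_add_sin A hA]
  simp

/-- Periodicity `exp((s + 2π)A) = exp(sA)`: the subgroup is compact. -/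
theorem expFlow_add_two_pi (s : ℝ) : expFlow A (s + 2 * Real.pi) = expFlow A s := by
  refine ContinuousLinearEquiv.ext (funext fun x => ?_)
  rw [expFlow_apply_eq_cos_add_sin A hA, expFlow_apply_eq_cos_add_sin A hA, Real.cos_add_two_pi,
    Real.sin_add_two_pi]

end ExpRotation

end SchwartzWeil
end HodgeCM
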